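import Summits.QuantumFields.YangMills.Theorems.BalabanUVNodesK0V23Stub3BoxSuppliers
import Summits.QuantumFields.YangMills.Theorems.BalabanUVNodesN22WindowSoftTwoPointAtRecord
import Summits.QuantumFields.YangMills.Theorems.BalabanUVNodesN22KernelLimitOfActivitySlots

/-!
# K0⁷ V23 — NODE O's box in N22's ACTIVITY-SLOT CURRENCY and in node U3's DECAY-SLOT CURRENCY, RE-HOMED ON THE V23 ROAD: the value half of N22's soft-localized two-point engine IS
# W1-19c's UNIFORM windowed (5.10) letter (one constant for all histories) for the localized-sum family; under W1-20's law it is the letter OF RECORD; with (1.21) it gives the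
# sign-free |β| box of `β₁₃(θ)`; node U3's decay slot `DecayBound ((objectsOfRecord₁₃ θ ℓ).EA 0) (Window θ.γ) E₁ δ₁` gives the box directly; at the print-regime Z3 window members
# each gives the TOKEN-FREE CORE of the V23 stub-3ᴬ′ᴮ text

Cell `pub-ymgap`, width seat `pub-ymgap-dag-n07-w3` (g16; N07 [B11] ∕ K0⁷ junction).  `--kind proof --supports stmt-QuantumFields-20541 --as helper`, COUNT-NEUTRAL.  NEW leaf; theorems
only — 0 `def`, 0 `sorry`.  Imports ONLY green, residue-free, route-independent modules: this seat's INTENT-3 `…K0V23Stub3BoxSuppliers` (the θ-generic two-letter road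
`abs_betaOfRecord₁₃_le_∕exists_absBetaBox_of_windowedDecayUniform_of_polLimitsExist`, `abs_betaOfRecord₁₃_le_of_kernelDecayWindowUniform`, the window edition `tokenFreeZB_of_windowBoxAtZB`),
dag-n22-w2's `…N22WindowSoftTwoPointAtRecord` (the soft-localized activity-slot engine: `abs_polWindow_localizedSum_le_soft_of_activitySlots`, `valueSummand_le_softMajorant`,
`eventually_le_of_softSum_domSys`) and dag-n22-w3's `…N22KernelLimitOfActivitySlots` (`polLimitsExistOfRecord₁₃_of_activitySlots`: (1.21) from the same slots + (S≈)).
[I] = [Balaban1987RG1]; [II] = [Balaban1989LargeFieldII]; [RG2] = [Balaban1988RG2Cluster]; [15] = [Balaban1985Variational].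

WHY.  The K1 face of record (#11396, dag-n24-c) and the whole stub-3 lane read NODE O's box in N22's ACTIVITY currency through k0-s3-w2's `…K0Stub3FinVolFaceOfActivitySlots` →
`…K0Stub3SocketWindowEdition.absBoxAt_of_activitySlotsAtWindowWitness` — modules on node00-def-R's §RESIDUE list (red after today's Stage-2 seam; they import the V19-era `…K0V19Stub2Prime`).
dag-n24-c's POST-SEAM ROADMAP (bus 2026-08-30 I.18314) sizes the K1 re-key as a four-lane job whose K0 inputs must exist on the ᴮ∕V23 road.  THIS FILE supplies the activity-slot and
decay-slot inputs there, and in a sharper shape than the residue: (§1) the engine's VALUE bound, generic over the reading `localizedSum F S emb`, concluded AS W1-19c's letter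
`WindowedDecayUniform F (localizedSum F S emb) ρ bV W C_unif δ₁` BY NAME (all direction pairs; the residue hid the same constant under a per-pair eventual bound) — proof = the engine's own
two junctions fed to `eventually_le_of_softSum_domSys`, verbatim k0-s3-w2's; (§2) under `Localizes17OfRecord₁₃ F N θ S emb` it IS `WindowedDecayUniformOfRecord₁₃ F N θ C_unif δ₁` (W1-19c's
`windowedDecayUniformOfRecord₁₃_iff_of_localizes`); (§3) with `PolLimitsExistOfRecord₁₃` — or with dag-n22-w3's (S≈) law supplying it from the same slots — the sign-free box
`|β₁₃(θ)| ≤ β′₅₁₀(C_unif, δ₁)` on `]0, θ.γ]` (INTENT-3's two-letter road); (§4) node U3's DECAY SLOT `DecayBound ((objectsOfRecord₁₃ F N θ ℓ).EA 0) (Window θ.γ) E₁ δ₁` — the OUTPUT SHAPE of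
dag-n22-c's J41 `decayBound_objectsOfRecord₁₃_of_outputCoordHolo` and of dag-n18-w4's `decayBound_EA_of_windowedDecayUniform` — ⟹ the box in one line (W1-19 `decayBound_EA_iff`); (§5) at the
print-regime Z3 window members `θ₁₃ᶜᶜᴹᵂᶻᴮ(j; γ₀; εbg := a₀; …)`, `0 < γ₀ ≤ ½`: the decay slot per radius ⟹ THE TOKEN-FREE CORE of ✓p769914 (the activity road at a member is §2∕§3 at
`θ := θ₁₃ᶜᶜᴹᵂᶻᴮ(…)` followed by `K0V23Stub3BoxSuppliers.tokenFreeZB_of_windowBoxAtZB`; its twenty-odd engine inputs are θ-indexed data and are NOT ∃-packed here).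

THE K0 β-BOX BILL IN N22's ACTIVITY CURRENCY (read off §3): towers ∕ reading with W1-20's `Localizes17OfRecord₁₃` ((1.7): NODE A ∕ N10), `Bound238` at every tower ∕ level on prefix sets
containing the window's cut histories ((1.18)-type VALUE bounds), holomorphic activities through complexified probe readings of the record's β-chart on balls of radius `r` and site-weight
tails `B₃e^{−δ₀·distCT}` ([I] p.264 «can be extended to an analytic function»; [15] §G), Road 1's numerals, `0 < κ`, and `PolLimitsExistOfRecord₁₃` ((1.21)) or (S≈) — NO differenced
(YoungLipschitz) slot, NO NE9, NO fading memory, NO run letter.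

HONEST FRAMING (binding).  By-name composition over LANDED green N22 ∕ W1 ∕ K0-V23 theorems + real bookkeeping; every engine input above and the decay slot are HYPOTHESES
(displayed, inhabited nowhere in the tree); NO estimate of Bałaban's proved or asserted; the token-free core ∕ stub 3ᴬ′ᴮ NOT proved ([I] §1 p.264 «uniformly bounded» STATED,
proof unpublished [II] p.355); V23 NOT registered; K0⁷ stmt-QuantumFields-20541 NOT closed; N22 ∕ K3⁸ untouched and NOT claimed; N07 NOT discharged; counts UNMOVED (typed 28∕28 ·
discharged 8∕28, route display 8∕27 excl. NODE O; K 1∕4); R4 = the CONDITIONAL finite-𝕋⁴ rung `BalabanLadder.UV` at fixed `ε = L^(−K)` only — NOT continuum ∕ ℝ⁴ ∕ OS; the Yang–Mills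
mass gap (Clay) is NOT proved by any of this.  Standard axioms only.
-/

noncomputable section

open Filter Topology Metric Set
open scoped BigOperators Matrix.Norms.L2Operator

namespace Summit.QuantumFields.YangMills.Theorems.K0V23Stub3ActivitySlotSuppliers

open Literature.MathematicalPhysics.QuantumFieldTheory.Balaban1983to89
open Literature.MathematicalPhysics.QuantumFieldTheory.Balaban1983to89.T4Continuum (T4Family)
open Literature.MathematicalPhysics.QuantumFieldTheory.Balaban1983to89.T4OutputRate (Window DecayBound)
open Literature.MathematicalPhysics.QuantumFieldTheory.Balaban1983to89.FlowStep (Box mem_box BetaLowerH BetaUpperH)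
open Literature.MathematicalPhysics.QuantumFieldTheory.Balaban1983to89.Node00 (TermFamily1 polWindow polScalar siteOfInt Stage13Params MatA mergedTermFamilyMatT TβOfRecord₁₃ chiβOfRecord₁₃
  betaOfRecord₁₃ theta13OfThm1CCMWZB theta13OfThm1CCMWZB_γ U3Letters₁₁)
open Literature.MathematicalPhysics.QuantumFieldTheory.Balaban1983to89.Node00.Sect2 (domCount domSys CPair)
open Literature.MathematicalPhysics.QuantumFieldTheory.Balaban1983to89.Node00.LocalizedSum17 (localizedSum ReadingMaps Localizes17OfRecord₁₃)
open Literature.MathematicalPhysics.QuantumFieldTheory.Balaban1983to89.Node00.W1 (ClusterTower)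
open Literature.MathematicalPhysics.QuantumFieldTheory.Balaban1983to89.Node00.U3OfKernels (histPrefix histPrefix_extd kernelA decayBound_EA_iff objectsOfRecord₁₃)
open Literature.MathematicalPhysics.QuantumFieldTheory.Balaban1983to89.Node00.U3KernelLetters (PolLimitsExistOfRecord₁₃)
open Literature.MathematicalPhysics.QuantumFieldTheory.Balaban1983to89.Node00.U3KernelLetters2 (WindowedDecayUniform WindowedDecayUniformOfRecord₁₃ windowedDecayUniformOfRecord₁₃_iff_of_localizes)
open Literature.MathematicalPhysics.QuantumFieldTheory.Balaban1983to89.B12Decay510 (delta1 delta1_pos)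
open Literature.MathematicalPhysics.QuantumFieldTheory.Balaban1983to89.B12Decay510Window (K₁)
open Literature.MathematicalPhysics.QuantumFieldTheory.Balaban1983to89.B12Decay510Torus (distCT nearT)
open Literature.MathematicalPhysics.QuantumFieldTheory.Balaban1983to89.B12TreeDecay (K₀ kappa₀ K₀_pos)
open Literature.MathematicalPhysics.QuantumFieldTheory.Balaban1983to89.TreeLengthTorus (TPt torusTreeLen torusTreeLen_nonneg)
open Literature.MathematicalPhysics.QuantumFieldTheory.Balaban1983to89.B12Sec2to5 (l1 Decay510 betaPrime510)
open YMDAG.N22.WindowOfLocalTerms (abs_polWindow_localizedSum_le_soft_of_activitySlots)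
open YMDAG.N22.WindowSoftTwoPoint (eventually_le_of_softSum_domSys valueSummand_le_softMajorant)
open YMDAG.N22.AtKernels (polLimitsExistOfRecord₁₃_of_activitySlots)
open Summit.QuantumFields.YangMills.Theorems.K0V23Stub3BoxSuppliers (abs_betaOfRecord₁₃_le_of_kernelDecayWindowUniform abs_betaOfRecord₁₃_le_of_windowedDecayUniform_of_polLimitsExist
  exists_absBetaBox_of_windowedDecayUniform_of_polLimitsExist tokenFreeZB_of_windowBoxAtZB)

/-! ## §1  GENERIC (any reading `localizedSum F S emb`, any window `W`): the engine's VALUE bound IS W1-19c's UNIFORM letter -/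

section Generic

variable (F : T4Family)
variable {𝔸 : Type*} [NormedRing 𝔸] [NormedAlgebra ℝ 𝔸] {V : Type*} [NormedAddCommGroup V] [NormedSpace ℝ V] {ι' : Type*} [Fintype ι']

open Classical in
/-- **★ THE VALUE HALF OF N22's SOFT-LOCALIZED TWO-POINT ENGINE IS W1-19c's UNIFORM WINDOWED (5.10) LETTER FOR THE LOCALIZED-SUM FAMILY.**  Hypotheses VERBATIM those of
dag-n22-w2's `windowedDecay_localizedSum_of_activitySlots` (towers `S K`, reading maps `emb`, chart `ρ ∕ bV`, window `W`, prefix sets `Wk`, spaces `sp`, `Bound238` with Road 1's numerals,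
complexified probe readings `Φ K k X` on open `U K k X ⊇ ball 0 r` extending `emb ∘ exp ρ` with holomorphic activities, site weights `w` with tails `B₃e^{−δ₀ distCT}`); conclusion:
`WindowedDecayUniform F (localizedSum F S emb) ρ bV W C_unif δ₁` — ONE constant `C_unif = (16·e·9·64·K₀(64,8)²·A·B₃²∕r²)·e^{12Mδ₁}·K₀(4·2⁴,8)·K₁(4,δ₀∕2)` for EVERY history, level,
direction pair and separation, `δ₁ = delta1 δ₀ κ (4M)`.  Proof = the engine's J30 value bound + value junction fed to `eventually_le_of_softSum_domSys` (k0-s3-w2's assembly, re-homed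
from the residue with the conclusion stated at the letter name).  CONDITIONAL on the displayed engine inputs; nothing asserted. [cite: Balaban1987RG1, (5.10) p.293, (1.18) p.263, (1.20) p.264, p.264 («can be extended to an analytic function»); Balaban1988RG2Cluster, (2.13)–(2.14) pp.14–15] -/
theorem windowedDecayUniform_localizedSum_of_activitySlots (m' : ℕ) (M : ℕ) [NeZero M] (hM : M = F.L ^ m')
    (S : (K : ℕ) → ClusterTower (F.P K) 𝔸 M) (emb : ReadingMaps F 𝔸 𝔸) (ρ : V →L[ℝ] 𝔸) (bV : Module.Basis ι' ℝ V) (W : Set (ℕ → ℝ))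
    (Wk : (K k : ℕ) → Set (Fin (k + 1) → ℝ)) (hWk : ∀ g ∈ W, ∀ K k, histPrefix g k ∈ Wk K k)
    (sp : (K k : ℕ) → (domSys (F.P K) M (k + 1)).Dom → Set (CPair (F.P K) 𝔸))
    {A R r₁ κ δ₀ B₃ r : ℝ}
    (hA : 0 ≤ A) (hr₁ : 0 ≤ r₁) (hκ : κ ≤ r₁) (hκ₀ : kappa₀ (4 * 2 ^ 4) (2 * 4) ≤ κ / 2) (hrate : r₁ + 2 * (64 * Real.log 162) + 2 ≤ R)
    (hsmall : A * Real.exp (5 * r₁ + 1) * K₀ 64 8 * 9 * 64 ≤ 1) (hδ₀ : 0 < δ₀) (hB₃ : 0 ≤ B₃) (hr : 0 < r)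
    (h238 : ∀ K k, ((S K) k).Bound238 (Wk K k) (sp K k) A R)
    (Ec : ℕ → ℕ → Type*) [∀ K k, NormedAddCommGroup (Ec K k)] [∀ K k, NormedSpace ℂ (Ec K k)]
    (ι : (K k : ℕ) → (domSys (F.P K) M (k + 1)).Dom → ((Fin (F.P K).d → Site (F.P K) (k + 1) → V) →L[ℝ] Ec K k))
    (Φ : (K k : ℕ) → (domSys (F.P K) M (k + 1)).Dom → Ec K k → CPair (F.P K) 𝔸)
    (U : (K k : ℕ) → (domSys (F.P K) M (k + 1)).Dom → Set (Ec K k)) (hU : ∀ K k X, IsOpen (U K k X)) (hrU : ∀ K k X, ball (0 : Ec K k) r ⊆ U K k X)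
    (hHhol : ∀ g ∈ W, ∀ (K k : ℕ) (X Z : (domSys (F.P K) M (k + 1)).Dom), Z.1 ⊆ X.1 →
      DifferentiableOn ℂ (fun z => ((S K) k).H (histPrefix g k) (Φ K k X z) Z) (U K k X))
    (hΦemb : ∀ (K k : ℕ) (X : (domSys (F.P K) M (k + 1)).Dom) (B : Fin (F.P K).d → Site (F.P K) (k + 1) → V),
      Φ K k X (ι K k X B) = emb K k (fun l t => NormedSpace.exp (ρ (B l t))))
    (hΦsp : ∀ (K k : ℕ) (X : (domSys (F.P K) M (k + 1)).Dom), ∀ z ∈ U K k X, ∀ Z : (domSys (F.P K) M (k + 1)).Dom, Z.1 ⊆ X.1 → Φ K k X z ∈ sp K k Z)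
    (w : (K k : ℕ) → (domSys (F.P K) M (k + 1)).Dom → Site (F.P K) (k + 1) → ℝ) (hw₀ : ∀ K k X t, 0 ≤ w K k X t)
    (hw : ∀ (K k : ℕ) (X : (domSys (F.P K) M (k + 1)).Dom) (l : Fin (F.P K).d) (t : Site (F.P K) (k + 1)) (c : ι'),
      ‖ι K k X (Pi.single l (Pi.single t (bV c)))‖ ≤ w K k X t)
    (htail : ∀ (K k : ℕ) (X : (domSys (F.P K) M (k + 1)).Dom) (t : Site (F.P K) (k + 1)),
      let e : Site (F.P K) (k + 1) → TPt 4 (domCount (F.P K) M (k + 1) * M) := fun x i => (ZMod.cast (x i) : ZMod (domCount (F.P K) M (k + 1) * M))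
      w K k X t ≤ B₃ * Real.exp (-δ₀ * distCT (domCount (F.P K) M (k + 1)) M (e t) (nearT (M := M) (e t) X))) :
    WindowedDecayUniform F (localizedSum F S emb) ρ bV W
      (16 * (Real.exp 1 * 9 * 64 * K₀ 64 8 ^ 2) * A * B₃ ^ 2 / r ^ 2 *
        Real.exp (delta1 δ₀ κ ((M : ℝ) * 4) * ((M : ℝ) * 4) * 3) * K₀ (4 * 2 ^ 4) (2 * 4) * K₁ 4 (δ₀ / 2) * 1)
      (delta1 δ₀ κ ((M : ℝ) * 4)) := by
  intro g hg k μ ν z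
  have hc : (0 : ℝ) ≤ Real.exp 1 * 9 * 64 * K₀ 64 8 ^ 2 := by have := K₀_pos 64 8; positivity
  have hCE : (0 : ℝ) ≤ 16 * (Real.exp 1 * 9 * 64 * K₀ 64 8 ^ 2) * A * B₃ ^ 2 / r ^ 2 := by positivity
  have h := eventually_le_of_softSum_domSys F (k + 1) m' M hM
    (fun K => |polWindow F K (k + 1) (localizedSum F S emb k (histPrefix g k) K) ρ bV μ ν z|)
    (fun K X => 16 * (Real.exp 1 * 9 * 64 * K₀ 64 8 ^ 2 * A * Real.exp (-(r₁ * torusTreeLen X.1))) / r ^ 2 *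
      (w K k X (siteOfInt F K (k + 1) z) * w K k X (siteOfInt F K (k + 1) 0)))
    hCE zero_le_one hδ₀ hκ₀ z (fun K => ?_) (fun K X => ?_)
  · filter_upwards [h] with K hK
    rw [neg_mul]
    exact hK
  · exact abs_polWindow_localizedSum_le_soft_of_activitySlots F S emb ρ bV k K (Wk K k) (sp K k) hA hr₁ hrate hsmall (h238 K k) (hWk g hg K k)
      (ι K k) (Φ K k) (U K k) (hU K k) hr (hrU K k) (hHhol g hg K k) (hΦemb K k) (hΦsp K k) (w K k) (hw₀ K k) (hw K k) μ ν z
  · exact valueSummand_le_softMajorant hc hA hr hB₃ (hw₀ K k X _) (Real.exp_nonneg _) (Real.exp_nonneg _) (htail K k X _) (htail K k X _) hκ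
      (torusTreeLen_nonneg _)

end Generic

/-! ## §2  AT THE RECORD: under W1-20's law the engine's value bound IS W1-19c's UNIFORM LETTER OF RECORD -/

section Record

variable (F : T4Family) (N : ℕ) [NeZero N]

open Classical in
/-- **★★ W1-19c's UNIFORM WINDOWED (5.10) LETTER OF RECORD `WindowedDecayUniformOfRecord₁₃ F N θ C_unif δ₁` FROM ACTIVITY-LEVEL VALUE SLOTS** — towers `S K : ClusterTower (F.P K) (MatA N) M`
and reading maps `emb : ReadingMaps F (MatA N) (MatA N)` with W1-20's law `Localizes17OfRecord₁₃ F N θ S emb`; the VALUE-half hypotheses of the engine at the record's β-chart (`θ.ρ8`, `θ.bV`) on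
the window `]0, θ.γ]^ℕ` (§1 at `W := Window θ.γ`, transported along the law by `windowedDecayUniformOfRecord₁₃_iff_of_localizes`).  This is exactly the letter node N18's kernel road and the
(D4) read-out consume, and the `hU` of INTENT-3's two-letter box road.  CONDITIONAL; nothing asserted. [cite: Balaban1987RG1, (1.7) p.261, (5.10) p.293, (1.18) p.263, (1.20) p.264; Balaban1988RG2Cluster, (2.13)–(2.14) pp.14–15] -/
theorem windowedDecayUniformOfRecord₁₃_of_activitySlots (θ : Stage13Params F N) (m' : ℕ) (M : ℕ) [NeZero M] (hM : M = F.L ^ m')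
    (S : (K : ℕ) → ClusterTower (F.P K) (MatA N) M) (emb : ReadingMaps F (MatA N) (MatA N)) (hloc : Localizes17OfRecord₁₃ F N θ S emb)
    (Wk : (K k : ℕ) → Set (Fin (k + 1) → ℝ)) (hWk : ∀ g ∈ Window θ.γ, ∀ K k, histPrefix g k ∈ Wk K k)
    (sp : (K k : ℕ) → (domSys (F.P K) M (k + 1)).Dom → Set (CPair (F.P K) (MatA N)))
    {A R r₁ κ δ₀ B₃ r : ℝ}
    (hA : 0 ≤ A) (hr₁ : 0 ≤ r₁) (hκ : κ ≤ r₁) (hκ₀ : kappa₀ (4 * 2 ^ 4) (2 * 4) ≤ κ / 2) (hrate : r₁ + 2 * (64 * Real.log 162) + 2 ≤ R)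
    (hsmall : A * Real.exp (5 * r₁ + 1) * K₀ 64 8 * 9 * 64 ≤ 1) (hδ₀ : 0 < δ₀) (hB₃ : 0 ≤ B₃) (hr : 0 < r)
    (h238 : ∀ K k, ((S K) k).Bound238 (Wk K k) (sp K k) A R)
    (Ec : ℕ → ℕ → Type*) [∀ K k, NormedAddCommGroup (Ec K k)] [∀ K k, NormedSpace ℂ (Ec K k)]
    (ι : letI := θ.instVβ₁; letI := θ.instVβ₂
      (K k : ℕ) → (domSys (F.P K) M (k + 1)).Dom → ((Fin (F.P K).d → Site (F.P K) (k + 1) → θ.Vβ) →L[ℝ] Ec K k))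
    (Φ : (K k : ℕ) → (domSys (F.P K) M (k + 1)).Dom → Ec K k → CPair (F.P K) (MatA N))
    (U : (K k : ℕ) → (domSys (F.P K) M (k + 1)).Dom → Set (Ec K k)) (hU : ∀ K k X, IsOpen (U K k X)) (hrU : ∀ K k X, ball (0 : Ec K k) r ⊆ U K k X)
    (hHhol : ∀ g ∈ Window θ.γ, ∀ (K k : ℕ) (X Z : (domSys (F.P K) M (k + 1)).Dom), Z.1 ⊆ X.1 →
      DifferentiableOn ℂ (fun z => ((S K) k).H (histPrefix g k) (Φ K k X z) Z) (U K k X))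
    (hΦemb : letI := θ.instVβ₁; letI := θ.instVβ₂
      ∀ (K k : ℕ) (X : (domSys (F.P K) M (k + 1)).Dom) (B : Fin (F.P K).d → Site (F.P K) (k + 1) → θ.Vβ),
        Φ K k X (ι K k X B) = emb K k (fun l t => NormedSpace.exp (θ.ρ8 (B l t))))
    (hΦsp : ∀ (K k : ℕ) (X : (domSys (F.P K) M (k + 1)).Dom), ∀ z ∈ U K k X, ∀ Z : (domSys (F.P K) M (k + 1)).Dom, Z.1 ⊆ X.1 → Φ K k X z ∈ sp K k Z)
    (w : (K k : ℕ) → (domSys (F.P K) M (k + 1)).Dom → Site (F.P K) (k + 1) → ℝ) (hw₀ : ∀ K k X t, 0 ≤ w K k X t)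
    (hw : letI := θ.instVβ₁; letI := θ.instVβ₂; letI := θ.instιβ
      ∀ (K k : ℕ) (X : (domSys (F.P K) M (k + 1)).Dom) (l : Fin (F.P K).d) (t : Site (F.P K) (k + 1)) (c : θ.ιβ),
        ‖ι K k X (Pi.single l (Pi.single t (θ.bV c)))‖ ≤ w K k X t)
    (htail : ∀ (K k : ℕ) (X : (domSys (F.P K) M (k + 1)).Dom) (t : Site (F.P K) (k + 1)),
      let e : Site (F.P K) (k + 1) → TPt 4 (domCount (F.P K) M (k + 1) * M) := fun x i => (ZMod.cast (x i) : ZMod (domCount (F.P K) M (k + 1) * M))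
      w K k X t ≤ B₃ * Real.exp (-δ₀ * distCT (domCount (F.P K) M (k + 1)) M (e t) (nearT (M := M) (e t) X))) :
    WindowedDecayUniformOfRecord₁₃ F N θ
      (16 * (Real.exp 1 * 9 * 64 * K₀ 64 8 ^ 2) * A * B₃ ^ 2 / r ^ 2 *
        Real.exp (delta1 δ₀ κ ((M : ℝ) * 4) * ((M : ℝ) * 4) * 3) * K₀ (4 * 2 ^ 4) (2 * 4) * K₁ 4 (δ₀ / 2) * 1)
      (delta1 δ₀ κ ((M : ℝ) * 4)) := by
  letI := θ.instVβ₁; letI := θ.instVβ₂; letI := θ.instιβ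
  exact (windowedDecayUniformOfRecord₁₃_iff_of_localizes F N θ S emb hloc _ _).2
    (windowedDecayUniform_localizedSum_of_activitySlots F m' M hM S emb θ.ρ8 θ.bV (Window θ.γ) Wk hWk sp hA hr₁ hκ hκ₀ hrate hsmall hδ₀ hB₃ hr
      h238 Ec ι Φ U hU hrU hHhol hΦemb hΦsp w hw₀ hw htail)

/-! ## §3  … hence, with (1.21), the sign-free box `|β₁₃(θ)| ≤ β′₅₁₀(C_unif, δ₁)` on the full window (INTENT-3's two-letter road) -/

open Classical in
/-- **★★ `|β₁₃(θ)_{k+1}(v)| ≤ β′₅₁₀(C_unif, δ₁)` ON EVERY BOX OF THE FULL WINDOW FROM THE VALUE HALF OF THE ENGINE + (1.21)** (`0 < κ`; `δ₁ = ½min{δ₀, κ(4M)⁻¹} > 0` by `delta1_pos`).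
NO YoungLipschitz slot, NO NE9, NO fading memory.  CONDITIONAL; nothing asserted. [cite: Balaban1987RG1, (1.20)–(1.22) p.264, §1 p.264, (5.10) p.293, (5.42) p.297] -/
theorem abs_betaOfRecord₁₃_le_of_activitySlots (θ : Stage13Params F N) (hlim : PolLimitsExistOfRecord₁₃ F N θ) (m' : ℕ) (M : ℕ) [NeZero M] (hM : M = F.L ^ m')
    (S : (K : ℕ) → ClusterTower (F.P K) (MatA N) M) (emb : ReadingMaps F (MatA N) (MatA N)) (hloc : Localizes17OfRecord₁₃ F N θ S emb)
    (Wk : (K k : ℕ) → Set (Fin (k + 1) → ℝ)) (hWk : ∀ g ∈ Window θ.γ, ∀ K k, histPrefix g k ∈ Wk K k)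
    (sp : (K k : ℕ) → (domSys (F.P K) M (k + 1)).Dom → Set (CPair (F.P K) (MatA N)))
    {A R r₁ κ δ₀ B₃ r : ℝ} (hκpos : 0 < κ)
    (hA : 0 ≤ A) (hr₁ : 0 ≤ r₁) (hκ : κ ≤ r₁) (hκ₀ : kappa₀ (4 * 2 ^ 4) (2 * 4) ≤ κ / 2) (hrate : r₁ + 2 * (64 * Real.log 162) + 2 ≤ R)
    (hsmall : A * Real.exp (5 * r₁ + 1) * K₀ 64 8 * 9 * 64 ≤ 1) (hδ₀ : 0 < δ₀) (hB₃ : 0 ≤ B₃) (hr : 0 < r)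
    (h238 : ∀ K k, ((S K) k).Bound238 (Wk K k) (sp K k) A R)
    (Ec : ℕ → ℕ → Type*) [∀ K k, NormedAddCommGroup (Ec K k)] [∀ K k, NormedSpace ℂ (Ec K k)]
    (ι : letI := θ.instVβ₁; letI := θ.instVβ₂
      (K k : ℕ) → (domSys (F.P K) M (k + 1)).Dom → ((Fin (F.P K).d → Site (F.P K) (k + 1) → θ.Vβ) →L[ℝ] Ec K k))
    (Φ : (K k : ℕ) → (domSys (F.P K) M (k + 1)).Dom → Ec K k → CPair (F.P K) (MatA N))
    (U : (K k : ℕ) → (domSys (F.P K) M (k + 1)).Dom → Set (Ec K k)) (hU : ∀ K k X, IsOpen (U K k X)) (hrU : ∀ K k X, ball (0 : Ec K k) r ⊆ U K k X)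
    (hHhol : ∀ g ∈ Window θ.γ, ∀ (K k : ℕ) (X Z : (domSys (F.P K) M (k + 1)).Dom), Z.1 ⊆ X.1 →
      DifferentiableOn ℂ (fun z => ((S K) k).H (histPrefix g k) (Φ K k X z) Z) (U K k X))
    (hΦemb : letI := θ.instVβ₁; letI := θ.instVβ₂
      ∀ (K k : ℕ) (X : (domSys (F.P K) M (k + 1)).Dom) (B : Fin (F.P K).d → Site (F.P K) (k + 1) → θ.Vβ),
        Φ K k X (ι K k X B) = emb K k (fun l t => NormedSpace.exp (θ.ρ8 (B l t))))
    (hΦsp : ∀ (K k : ℕ) (X : (domSys (F.P K) M (k + 1)).Dom), ∀ z ∈ U K k X, ∀ Z : (domSys (F.P K) M (k + 1)).Dom, Z.1 ⊆ X.1 → Φ K k X z ∈ sp K k Z)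
    (w : (K k : ℕ) → (domSys (F.P K) M (k + 1)).Dom → Site (F.P K) (k + 1) → ℝ) (hw₀ : ∀ K k X t, 0 ≤ w K k X t)
    (hw : letI := θ.instVβ₁; letI := θ.instVβ₂; letI := θ.instιβ
      ∀ (K k : ℕ) (X : (domSys (F.P K) M (k + 1)).Dom) (l : Fin (F.P K).d) (t : Site (F.P K) (k + 1)) (c : θ.ιβ),
        ‖ι K k X (Pi.single l (Pi.single t (θ.bV c)))‖ ≤ w K k X t)
    (htail : ∀ (K k : ℕ) (X : (domSys (F.P K) M (k + 1)).Dom) (t : Site (F.P K) (k + 1)),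
      let e : Site (F.P K) (k + 1) → TPt 4 (domCount (F.P K) M (k + 1) * M) := fun x i => (ZMod.cast (x i) : ZMod (domCount (F.P K) M (k + 1) * M))
      w K k X t ≤ B₃ * Real.exp (-δ₀ * distCT (domCount (F.P K) M (k + 1)) M (e t) (nearT (M := M) (e t) X)))
    (k : ℕ) (v : Fin (k + 1) → ℝ) (hv : v ∈ Box θ.γ k) :
    |betaOfRecord₁₃ F N θ k v| ≤ betaPrime510 4
      (16 * (Real.exp 1 * 9 * 64 * K₀ 64 8 ^ 2) * A * B₃ ^ 2 / r ^ 2 *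
        Real.exp (delta1 δ₀ κ ((M : ℝ) * 4) * ((M : ℝ) * 4) * 3) * K₀ (4 * 2 ^ 4) (2 * 4) * K₁ 4 (δ₀ / 2) * 1)
      (delta1 δ₀ κ ((M : ℝ) * 4)) := by
  have hM4 : (0 : ℝ) < (M : ℝ) * 4 := by
    have : (0 : ℝ) < (M : ℝ) := Nat.cast_pos.2 (Nat.pos_of_neZero M)
    positivity
  exact abs_betaOfRecord₁₃_le_of_windowedDecayUniform_of_polLimitsExist F N θ (delta1_pos hδ₀ hκpos hM4) hlim
    (windowedDecayUniformOfRecord₁₃_of_activitySlots F N θ m' M hM S emb hloc Wk hWk sp hA hr₁ hκ hκ₀ hrate hsmall hδ₀ hB₃ hr h238 Ec ι Φ U hU hrU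
      hHhol hΦemb hΦsp w hw₀ hw htail) k v hv

open Classical in
/-- **★★★ THE SIGN-FREE BOX ON N22's ACTIVITY-LEVEL LETTERS + LAWS ALONE** (`0 < θ.γ`): the (1.21) letter is dag-n22-w3's `polLimitsExistOfRecord₁₃_of_activitySlots` from the SAME
towers ∕ reading ∕ value slot ∕ complexified readings ∕ tails plus the displayed law (S≈) «approximate cross-volume stability of the localized polarisation sums» (locality cut `lo` with
`hlo`, ratio `0 ≤ r₀ < 1`, `hS`), Road 1's sharper `κ₀(64,8) ≤ κ∕4`, holomorphy on the prefix sets; ⊢ `∃ β′ ≥ 0`, `−β′ ≤ β₁₃(θ) ≤ β′` on every `]0, θ.γ]^{k+1}` (`β′ = β′₅₁₀(C_unif, δ₁)`).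
NO kernel-level letter remains.  CONDITIONAL on the activity-level hypotheses (displayed, inhabited nowhere); nothing of Bałaban asserted. [cite: Balaban1987RG1, (1.7) p.261, (1.18) p.263, (1.20)–(1.22) p.264, §1 p.264, (5.10) p.293; Balaban1988RG2Cluster, (2.13)–(2.14) pp.14–15; Balaban1989LargeFieldII, p.355] -/
theorem exists_absBetaBox_of_activitySlots_of_approxStable (θ : Stage13Params F N) (hγ : 0 < θ.γ) (m' : ℕ) (M : ℕ) [NeZero M] (hM : M = F.L ^ m')
    (S : (K : ℕ) → ClusterTower (F.P K) (MatA N) M) (emb : ReadingMaps F (MatA N) (MatA N)) (hloc : Localizes17OfRecord₁₃ F N θ S emb)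
    (Wk : (K k : ℕ) → Set (Fin (k + 1) → ℝ)) (hWk : ∀ g ∈ Window θ.γ, ∀ K k, histPrefix g k ∈ Wk K k)
    (sp : (K k : ℕ) → (domSys (F.P K) M (k + 1)).Dom → Set (CPair (F.P K) (MatA N)))
    {A R r₁ κ δ₀ B₃ r r₀ : ℝ} (hκpos : 0 < κ)
    (hA : 0 ≤ A) (hr₁ : 0 ≤ r₁) (hκ : κ ≤ r₁) (hκ4 : kappa₀ (4 * 2 ^ 4) (2 * 4) ≤ κ / 2 / 2) (hrate : r₁ + 2 * (64 * Real.log 162) + 2 ≤ R)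
    (hsmall : A * Real.exp (5 * r₁ + 1) * K₀ 64 8 * 9 * 64 ≤ 1) (hδ₀ : 0 < δ₀) (hB₃ : 0 ≤ B₃) (hr : 0 < r)
    (h238 : ∀ K k, ((S K) k).Bound238 (Wk K k) (sp K k) A R)
    (Ec : ℕ → ℕ → Type*) [∀ K k, NormedAddCommGroup (Ec K k)] [∀ K k, NormedSpace ℂ (Ec K k)]
    (ι : letI := θ.instVβ₁; letI := θ.instVβ₂
      (K k : ℕ) → (domSys (F.P K) M (k + 1)).Dom → ((Fin (F.P K).d → Site (F.P K) (k + 1) → θ.Vβ) →L[ℝ] Ec K k))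
    (Φ : (K k : ℕ) → (domSys (F.P K) M (k + 1)).Dom → Ec K k → CPair (F.P K) (MatA N))
    (U : (K k : ℕ) → (domSys (F.P K) M (k + 1)).Dom → Set (Ec K k)) (hU : ∀ K k X, IsOpen (U K k X)) (hrU : ∀ K k X, ball (0 : Ec K k) r ⊆ U K k X)
    (hHhol : ∀ K k, ∀ hist ∈ Wk K k, ∀ (X Z : (domSys (F.P K) M (k + 1)).Dom), Z.1 ⊆ X.1 →
      DifferentiableOn ℂ (fun z => ((S K) k).H hist (Φ K k X z) Z) (U K k X))
    (hΦemb : letI := θ.instVβ₁; letI := θ.instVβ₂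
      ∀ (K k : ℕ) (X : (domSys (F.P K) M (k + 1)).Dom) (B : Fin (F.P K).d → Site (F.P K) (k + 1) → θ.Vβ),
        Φ K k X (ι K k X B) = emb K k (fun l t => NormedSpace.exp (θ.ρ8 (B l t))))
    (hΦsp : ∀ (K k : ℕ) (X : (domSys (F.P K) M (k + 1)).Dom), ∀ z ∈ U K k X, ∀ Z : (domSys (F.P K) M (k + 1)).Dom, Z.1 ⊆ X.1 → Φ K k X z ∈ sp K k Z)
    (w : (K k : ℕ) → (domSys (F.P K) M (k + 1)).Dom → Site (F.P K) (k + 1) → ℝ) (hw₀ : ∀ K k X t, 0 ≤ w K k X t)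
    (hw : letI := θ.instVβ₁; letI := θ.instVβ₂; letI := θ.instιβ
      ∀ (K k : ℕ) (X : (domSys (F.P K) M (k + 1)).Dom) (l : Fin (F.P K).d) (t : Site (F.P K) (k + 1)) (c : θ.ιβ),
        ‖ι K k X (Pi.single l (Pi.single t (θ.bV c)))‖ ≤ w K k X t)
    (htail : ∀ (K k : ℕ) (X : (domSys (F.P K) M (k + 1)).Dom) (t : Site (F.P K) (k + 1)),
      let e : Site (F.P K) (k + 1) → TPt 4 (domCount (F.P K) M (k + 1) * M) := fun x i => (ZMod.cast (x i) : ZMod (domCount (F.P K) M (k + 1) * M))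
      w K k X t ≤ B₃ * Real.exp (-δ₀ * distCT (domCount (F.P K) M (k + 1)) M (e t) (nearT (M := M) (e t) X)))
    (lo : (k K : ℕ) → (domSys (F.P K) M (k + 1)).Dom → Prop) [∀ k K, DecidablePred (lo k K)]
    (hlo : ∀ (k K : ℕ) (X : (domSys (F.P K) M (k + 1)).Dom), ¬ lo k K X →
      let e : Site (F.P K) (k + 1) → TPt 4 (domCount (F.P K) M (k + 1) * M) := fun x i => (ZMod.cast (x i) : ZMod (domCount (F.P K) M (k + 1) * M))
      (K : ℝ) ≤ torusTreeLen X.1 ∨ (K : ℝ) ≤ distCT (domCount (F.P K) M (k + 1)) M (e (siteOfInt F K (k + 1) 0)) (nearT (M := M) (e (siteOfInt F K (k + 1) 0)) X))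
    (hr₀ : r₀ < 1) (hr₀' : 0 ≤ r₀)
    (hS : letI := θ.instVβ₁; letI := θ.instVβ₂; letI := θ.instιβ
      ∀ g ∈ Window θ.γ, ∀ (k : ℕ) (μ ν : Fin 4) (z : Fin 4 → ℤ), ∃ (K₀ : ℕ) (C : ℝ), ∀ K : ℕ, K₀ ≤ K →
      |∑ X ∈ Finset.univ.filter (lo k (K + 1)), polScalar (fun U' => (((S (K + 1)) k).E (histPrefix g k) (emb (K + 1) k U') X).re) θ.ρ8 θ.bV
            (Fin.cast (F.P_d (K + 1)).symm μ) (siteOfInt F (K + 1) (k + 1) z) (Fin.cast (F.P_d (K + 1)).symm ν) (siteOfInt F (K + 1) (k + 1) 0) -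
        ∑ X ∈ Finset.univ.filter (lo k K), polScalar (fun U' => (((S K) k).E (histPrefix g k) (emb K k U') X).re) θ.ρ8 θ.bV
            (Fin.cast (F.P_d K).symm μ) (siteOfInt F K (k + 1) z) (Fin.cast (F.P_d K).symm ν) (siteOfInt F K (k + 1) 0)| ≤ C * r₀ ^ K) :
    ∃ β' : ℝ, 0 ≤ β' ∧ BetaLowerH (-β') θ.γ (betaOfRecord₁₃ F N θ) ∧ BetaUpperH β' θ.γ (betaOfRecord₁₃ F N θ) := by
  have hκ₀ : kappa₀ (4 * 2 ^ 4) (2 * 4) ≤ κ / 2 := hκ4.trans (by linarith)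
  have hHholW : ∀ g ∈ Window θ.γ, ∀ (K k : ℕ) (X Z : (domSys (F.P K) M (k + 1)).Dom), Z.1 ⊆ X.1 →
      DifferentiableOn ℂ (fun z => ((S K) k).H (histPrefix g k) (Φ K k X z) Z) (U K k X) :=
    fun g hg K k X Z hZX => hHhol K k (histPrefix g k) (hWk g hg K k) X Z hZX
  have hlim : PolLimitsExistOfRecord₁₃ F N θ :=
    polLimitsExistOfRecord₁₃_of_activitySlots F N θ m' hM S emb hloc Wk hWk sp hA hr₁ hκpos hκ hκ4 hrate hsmall hB₃ hδ₀ hr h238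
      Ec ι Φ U hU hrU hHhol hΦemb hΦsp w hw₀ hw htail lo hlo hr₀ hr₀' hS
  have hM4 : (0 : ℝ) < (M : ℝ) * 4 := by
    have : (0 : ℝ) < (M : ℝ) := Nat.cast_pos.2 (Nat.pos_of_neZero M)
    positivity
  exact exists_absBetaBox_of_windowedDecayUniform_of_polLimitsExist F N θ (delta1_pos hδ₀ hκpos hM4) hγ hlim
    (windowedDecayUniformOfRecord₁₃_of_activitySlots F N θ m' M hM S emb hloc Wk hWk sp hA hr₁ hκ hκ₀ hrate hsmall hδ₀ hB₃ hr h238 Ec ι Φ U hU hrU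
      hHholW hΦemb hΦsp w hw₀ hw htail)

/-! ## §4  NODE U3's DECAY SLOT ⟹ the box in one line (the OUTPUT SHAPE of N22-c's J41 and of N18's `decayBound_EA_of_windowedDecayUniform`) -/

/-- **★★ NODE U3's DECAY SLOT OF RECORD ⟹ `|β₁₃(θ)_{k+1}(v)| ≤ β′₅₁₀(E₁, δ₁)` ON EVERY BOX OF THE FULL WINDOW** (`0 < δ₁`): `DecayBound ((objectsOfRecord₁₃ F N θ ℓ).EA 0) (Window θ.γ) E₁ δ₁`
— the conclusion shape of dag-n22-c's J41 `decayBound_objectsOfRecord₁₃_of_outputCoordHolo` (output-level margin datum) and of dag-n18-w4's junction `decayBound_EA_of_windowedDecayUniform`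
(uniform letter + (1.21)) — is, by W1-19's `decayBound_EA_iff`, one-constant (5.10) decay of the limiting kernels over the window; INTENT-3's `abs_betaOfRecord₁₃_le_of_kernelDecayWindowUniform`
reads the box off.  θ-GENERIC; CONDITIONAL on the slot; nothing asserted. [cite: Balaban1987RG1, (1.18) p.263, (1.20)–(1.22) p.264, §1 p.264, (5.10) p.293, (5.42) p.297] -/
theorem abs_betaOfRecord₁₃_le_of_decayBoundEA (θ : Stage13Params F N) (ℓ : U3Letters₁₁) {E₁ δ₁ : ℝ} (hδ : 0 < δ₁)
    (h : DecayBound ((objectsOfRecord₁₃ F N θ ℓ).EA 0) (Window θ.γ) E₁ δ₁) (k : ℕ) (v : Fin (k + 1) → ℝ) (hv : v ∈ Box θ.γ k) :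
    |betaOfRecord₁₃ F N θ k v| ≤ betaPrime510 4 E₁ δ₁ := by
  letI := θ.instVβ₁; letI := θ.instVβ₂; letI := θ.instιβ
  have hdec := (decayBound_EA_iff F (mergedTermFamilyMatT F N (TβOfRecord₁₃ F N) (chiβOfRecord₁₃ F N θ) θ.εbg) θ.ρ8 θ.bV (Window θ.γ) E₁ δ₁).1 h
  exact abs_betaOfRecord₁₃_le_of_kernelDecayWindowUniform F N θ hδ le_rfl (fun g hg k => hdec g hg k 0 1) k v hv

/-- **★★ THE SIGN-FREE β-BOX ON THE FULL WINDOW FROM NODE U3's DECAY SLOT** (∃-form with `0 ≤ β′`; `0 < θ.γ`).  θ-GENERIC; CONDITIONAL on the slot. [cite: Balaban1987RG1, (1.20)–(1.22) p.264, §1 p.264 («uniformly bounded»), (5.10) p.293] -/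
theorem exists_absBetaBox_of_decayBoundEA (θ : Stage13Params F N) (ℓ : U3Letters₁₁) {E₁ δ₁ : ℝ} (hδ : 0 < δ₁) (hγ : 0 < θ.γ)
    (h : DecayBound ((objectsOfRecord₁₃ F N θ ℓ).EA 0) (Window θ.γ) E₁ δ₁) :
    ∃ β' : ℝ, 0 ≤ β' ∧ BetaLowerH (-β') θ.γ (betaOfRecord₁₃ F N θ) ∧ BetaUpperH β' θ.γ (betaOfRecord₁₃ F N θ) := by
  have key := abs_betaOfRecord₁₃_le_of_decayBoundEA F N θ ℓ hδ h
  have hv0 : (fun _ : Fin (0 + 1) => θ.γ) ∈ Box θ.γ 0 := mem_box.mpr fun _ => ⟨hγ, le_rfl⟩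
  exact ⟨betaPrime510 4 E₁ δ₁, (abs_nonneg _).trans (key 0 _ hv0), fun k v hv => (abs_le.mp (key k v hv)).1, fun k v hv => (abs_le.mp (key k v hv)).2⟩

end Record

/-! ## §5  At the print-regime Z3 window members: the decay slot per radius ⟹ THE TOKEN-FREE CORE of the V23 stub-3ᴬ′ᴮ text -/

section ZB

variable (F : T4Family)

/-- **★★ NODE U3's DECAY SLOT AT A WINDOW MEMBER, PER RADIUS ⟹ THE TOKEN-FREE CORE**: for every `a₀ > 0` SOME `γ₀ ∈ ]0, ½]`, `ε₂₉ > 0`, letters, a block `ℓ`, a rate `δ₁ > 0` and a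
constant `E₁` with `DecayBound ((objectsOfRecord₁₃ F 2 θ ℓ).EA 0) (Window γ₀) E₁ δ₁` at `θ := θ₁₃ᶜᶜᴹᵂᶻᴮ(j; γ₀; a₀; ε₀, ε₂₉; B₃, B₃′, a₀, a₁; Efl, logz)` (window `γ₀`) ⟹ the token-free core
(§4 at `θ`, then INTENT-3's window edition).  With §2∕§3 at `θ` (activity currency) or dag-n22-c's J41 ∕ node N18's junction at `θ` as the slot's producer, this is the V23-road form of the
residue's `absBoxAt_of_activitySlotsAtWindowWitness` road the K1 face of record consumed.  CONDITIONAL on the slot; nothing asserted. [cite: Balaban1987RG1, (1.18) p.263, (1.20)–(1.22) p.264, §1 p.264, (5.10) p.293; Balaban1989LargeFieldII, p.355] -/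
theorem tokenFreeZB_of_decayBoundEAAtZB
    (h : ∀ a₀ : ℝ, 0 < a₀ → ∃ (γ₀ ε₂₉ : ℝ) (j : ℕ) (ε₀ B₃ B₃' a₁ : ℝ) (Efl logz : B12.RunParams → ℕ → ℝ) (ℓ : U3Letters₁₁) (E₁ δ₁ : ℝ),
      0 < γ₀ ∧ γ₀ ≤ 1 / 2 ∧ 0 < ε₂₉ ∧ 0 < δ₁ ∧
      DecayBound ((objectsOfRecord₁₃ F 2 (theta13OfThm1CCMWZB F 2 j γ₀ a₀ ε₀ ε₂₉ B₃ B₃' a₀ a₁ Efl logz) ℓ).EA 0) (Window γ₀) E₁ δ₁) :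
    ∀ a₀ : ℝ, 0 < a₀ → ∃ γ₀ ε₂₉ β' : ℝ, 0 < γ₀ ∧ 0 < ε₂₉ ∧ ∀ (j : ℕ) (ε₀ B₃ B₃' a₁ : ℝ),
      BetaLowerH (-β') γ₀ (betaOfRecord₁₃ F 2 (theta13OfThm1CCMWZB F 2 j (1 / 2) a₀ ε₀ ε₂₉ B₃ B₃' a₀ a₁ (fun _ _ => 0) (fun _ _ => 0))) ∧
      BetaUpperH β' γ₀ (betaOfRecord₁₃ F 2 (theta13OfThm1CCMWZB F 2 j (1 / 2) a₀ ε₀ ε₂₉ B₃ B₃' a₀ a₁ (fun _ _ => 0) (fun _ _ => 0))) := by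
  refine tokenFreeZB_of_windowBoxAtZB F fun a₀ ha₀ => ?_
  obtain ⟨γ₀, ε₂₉, j, ε₀, B₃, B₃', a₁, Efl, logz, ℓ, E₁, δ₁, hγ₀, hγhalf, hε', hδ, hD⟩ := h a₀ ha₀
  have hγθ : (theta13OfThm1CCMWZB F 2 j γ₀ a₀ ε₀ ε₂₉ B₃ B₃' a₀ a₁ Efl logz).γ = γ₀ := theta13OfThm1CCMWZB_γ F 2 j γ₀ a₀ ε₀ ε₂₉ B₃ B₃' a₀ a₁ Efl logz
  have hγpos : 0 < (theta13OfThm1CCMWZB F 2 j γ₀ a₀ ε₀ ε₂₉ B₃ B₃' a₀ a₁ Efl logz).γ := by rw [hγθ]; exact hγ₀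
  rw [← hγθ] at hD
  obtain ⟨β', -, hlow, hup⟩ := exists_absBetaBox_of_decayBoundEA F 2 _ ℓ hδ hγpos hD
  rw [hγθ] at hlow hup
  exact ⟨γ₀, ε₂₉, β', j, ε₀, B₃, B₃', a₁, Efl, logz, hγ₀, hγhalf, hε', hlow, hup⟩

end ZB

end Summit.QuantumFields.YangMills.Theorems.K0V23Stub3ActivitySlotSuppliers

end
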